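import Summits.BirchSwinnertonDyer.BirchSwinnertonDyer.Theorems.RamifiedHeegnerPairLeafRankZeroUpperAtThreeShimuraInertPairingCore
import Summits.BirchSwinnertonDyer.BirchSwinnertonDyer.Theorems.RamifiedHeegnerPairLeafRankZeroUpperAtThreeShimuraInertVariants
import Summits.BirchSwinnertonDyer.BirchSwinnertonDyer.Theorems.RamifiedHeegnerPairLeafRankZeroUpperAtThreeShimuraInertComposition
import Summits.BirchSwinnertonDyer.BirchSwinnertonDyer.Theorems.RamifiedHeegnerPairLeafRankOneUpperAtThreeShimuraInertPairingComposition
import HarnessLib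

/-!
# Route `RamifiedHeegnerPair`, crux U₀ `LeafRankZeroUpperAtThree` (stmt-BirchSwinnertonDyer-26024), line `splitkolyvagin0` —
# the INERT-CARRIER (Shimura-curve) road for U₀, part 7: the PAIRING-Shimura rows (full Papikian–Rabinoff, `q = 2` allowed) —
# supply from the named facts ∧ L₁, the weakening Σ★⁵₀ ⟹ Σ★⁶₀, and THE COMPOSITION of skeleton v9

HONEST FRAMING. Theorems only; helper file (`--supports stmt-BirchSwinnertonDyer-26024 --as helper`); nothing is booked, no item is
closed, BSD is not proved for any curve; CONDITIONAL on every displayed input. Lead prover bsd-line-rhp-p2 g10, 2026-08-28.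
The U₁ twin is `…LeafRankOneUpperAtThreeShimuraInertPairingComposition.lean` (part 10 of the U₁ files); «pairing-Shimura row» as there
(third (DEG) mechanism: a half-size subset `R ⊆ S` of primes each `2` or with `3 ∤ q − 1`; part U0-6's core). Census (rank-zero Gss2,
`N < 5·10⁵`): nonempty pairing-Shimura rows 59 of the 103 multi-carrier classes (v8's Shimura rows: 51), so Σ★⁶₀'s content = 44.

* `leafRankZeroUpper_three_of_shimuraInert_of_lowerRankOne_pairing` — U₀ at a leaf curve on a nonempty pairing-Shimura row ⟸ {GZK,
  modularity ×2, JL, Pasten §6 CO (full 6.18), CST14+JSW17 on `X_{N⁺,N⁻}`, FH simple-zero inert-split} ∧ L₁ — no Σ, no L₀.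
  -- adapted from Summits/BirchSwinnertonDyer/BirchSwinnertonDyer/Theorems/RamifiedHeegnerPairLeafRankZeroUpperAtThreeShimuraInertSupply.lean
* `sigmaStarOptOffPairingRowsNe_of_sigmaStarOptOffShimuraRowsNe` (Σ★⁵₀ ⟹ Σ★⁶₀; chain 27493 ⟹ Σ★‴ ⟹ Σ★⁵₀ ⟹ Σ★⁶₀ by name).
* `leafRankZeroUpperAtThree_of_pubManin_of_namedFacts_of_shimuraFactsZero_of_sigmaStarOptOffPairingRowsNe_of_lowerRankOne_of_lowerRankZero`
  — the v9 composition: PUB₀⁺ → F1–F3 → (JL, CO, HK, FH-simpleZero) → Σ★⁶₀ → L₁ → L₀ → `LeafRankZeroUpperAtThree`.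
  -- adapted from Summits/BirchSwinnertonDyer/BirchSwinnertonDyer/Theorems/RamifiedHeegnerPairLeafRankZeroUpperAtThreeShimuraInertComposition.lean

References: [cite: PastenShimura2024, Prop. 6.13, Lemmas 6.15–6.16, Lemma 6.18 (p. 24), §6.9] [cite: PapikianRabinoff2016, Cor. 3.5]
[cite: JetchevSkinnerWan2017, §7.4.1–7.4.2, Thm. 4.4.1] [cite: CaiShuTian2014, Thm. 1.5] [cite: FriedbergHoffstein1995, Thm. B]
[cite: Jetchev2008, Conj. 1.3, Thm. 1.4 (p. 812)] [cite: Miller2011LMS, Def. 1.1].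
-/

-- D-0017: single-problem summit, so `Summit.BirchSwinnertonDyer.BirchSwinnertonDyer.…` repeats a namespace BY DESIGN.
set_option linter.dupNamespace false
set_option autoImplicit false

noncomputable section

open scoped Classical NumberField

open WeierstrassCurve NumberField IsDedekindDomain Literature Literature.NumberTheory.EllipticCurves
  Rat.HeightOneSpectrum CongruenceSubgroup
  Literature.NumberTheory.EllipticCurves.ModularForms
  Literature.NumberTheory.EllipticCurves.Rank1Residual
  Literature.NumberTheory.EllipticCurves.Rank1Residual.Typed
  Literature.NumberTheory.QuadraticFields.Quadratic
  Literature.NumberTheory.GaloisCohomology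
  Literature.NumberTheory.Automorphic
  Summit.BirchSwinnertonDyer.Rank1Residual
  Summit.BirchSwinnertonDyer.Rank1Residual.Additive
  Summit.BirchSwinnertonDyer.Rank1Residual.X11b
  Summit.BirchSwinnertonDyer.Rank1Residual.X11b.Three
  Summit.BirchSwinnertonDyer.BirchSwinnertonDyer.Theses.RamifiedHeegnerPair
  Summit.BirchSwinnertonDyer.BirchSwinnertonDyer.Theorems
  Summit.BirchSwinnertonDyer.BirchSwinnertonDyer.Theorems.RamifiedPairUpperBound

namespace Summit.BirchSwinnertonDyer.BirchSwinnertonDyer.Theorems.LeafShimuraInert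

/-! ## §U0.7.1 U₀ on a pairing-Shimura row from the named facts and L₁ -/

/-- **U₀ AT A LEAF CURVE ON A NONEMPTY PAIRING-SHIMURA ROW, from PUBLISHED named facts and the deciding member L₁ — no Σ, no L₀.**
Part U0-3's `leafRankZeroUpper_three_of_shimuraInert_of_lowerRankOne` VERBATIM except the third (DEG) disjunct (PAIRING form) and the core
(part U0-6's `leafRankZeroUpper_three_of_shimuraInertDatum_at_pairing`). CONDITIONAL; nothing booked; U₀ / L₁ OPEN; BSD is not proved.
-- adapted from Summits/BirchSwinnertonDyer/BirchSwinnertonDyer/Theorems/RamifiedHeegnerPairLeafRankZeroUpperAtThreeShimuraInertSupply.lean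
[cite: FriedbergHoffstein1995, Thm. B] [cite: JetchevSkinnerWan2017, §7.4.1–7.4.2, Thm. 4.4.1] [cite: CaiShuTian2014, Thm. 1.5]
[cite: PastenShimura2024, Prop. 6.13, Lemmas 6.15–6.16, 6.18] [cite: PapikianRabinoff2016, Cor. 3.5] [cite: Miller2011LMS, Def. 1.1] -/
theorem leafRankZeroUpper_three_of_shimuraInert_of_lowerRankOne_pairing
    -- published inputs (named facts of the tree)
    (hGZK : rank_eq_analyticRank_of_analyticRank_le_one) (hmod : hasEntireLFunction_rat)
    (hnf : exists_isNewformOf) (hJL : nonempty_shimuraParametrizationData)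
    (hCO : PastenShimura2024_componentOrders)
    (hHK : shimuraCurve_heegnerPoint_grossZagier_kolyvagin)
    (hFH1 : friedbergHoffstein_exists_twist_simpleZero_inertAt_splitAt)
    -- the route member L₁ BY NAME
    (hL1 : Summit.BirchSwinnertonDyer.BirchSwinnertonDyer.Theses.RamifiedHeegnerPair.Gss2LowerAtThreeRankOne)
    -- the leaf curve (`r_an = 0`), with a datum whose constant is a `3`-unit
    (W : WeierstrassCurve ℚ) [W.IsElliptic] [W.IsGloballyMinimal]
    (hCM : ¬ W.HasCM) (hadd : Addv W 3) (hsub : SubGss W 3) (hr : W.analyticRank = 0)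
    {N : ℕ} [NeZero N] (hN : W.conductorNorm ℤ = N)
    (Dt : ModularParametrizationData W N) (hc : ¬ (3 : ℤ) ∣ Dt.c)
    -- the inert set (nonempty), SHAPE and (DEG)-availability
    (S : Finset ℕ) (hSeven : Even S.card) (hSne : S.Nonempty)
    (hSmult : ∀ ℓ ∈ S, ∃ _ : Fact ℓ.Prime, W.HasMultiplicativeReductionAtPrime ℓ)
    (hFC : ∀ (ℓ : ℕ) [Fact ℓ.Prime], ℓ ∉ S → W.HasSplitMultiplicativeReductionAtPrime ℓ →
      ¬ 3 ∣ padicValInt ℓ W.minimalDiscriminantInt)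
    (hshape : ∀ (q : ℕ) [Fact q.Prime], 3 ∣ (W.baseChange ℚ_[q]).localTamagawaNumber ℤ_[q] →
      W.HasSplitMultiplicativeReductionAtPrime q)
    (hDEG : (∃ ℓ₀ ∈ S, ¬ 3 ∣ padicValInt ℓ₀ W.minimalDiscriminantInt) ∨
      (∃ ℓ₀ t : ℕ, ∃ _ : Fact ℓ₀.Prime, ∃ _ : Fact t.Prime,
        W.HasMultiplicativeReductionAtPrime ℓ₀ ∧ W.HasMultiplicativeReductionAtPrime t ∧
        ℓ₀ ∉ S ∧ t ∉ S ∧ t ≠ ℓ₀ ∧ ¬ 3 ∣ padicValInt ℓ₀ W.minimalDiscriminantInt) ∨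
      (∃ R : Finset ℕ, R ⊆ S ∧ 2 * R.card = S.card ∧ ∀ q ∈ R, q = 2 ∨ ¬ 3 ∣ q - 1)) :
    Typed.MissingUpperBoundAt W 3 := by
  haveI h3F : Fact (Nat.Prime 3) := ⟨Nat.prime_three⟩
  have hp : (3 : ℕ).Prime := Nat.prime_three
  subst hN
  have hirr : W.HasIrreducibleModPGaloisRep 3 := Additive.irr_of_subGss_of_ne_two W 3 (by decide) hadd hsub
  -- the sign of the functional equation is `+1` (modularity, `r_an = 0`)
  have hw : W.rootNumber = 1 := by
    rw [WeierstrassCurve.rootNumber_eq_neg_one_pow_analyticRank_of_exists_isNewformOf hnf W, hr]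
    norm_num
  -- a good prime (to be split in the field; any will do)
  obtain ⟨p₀, hp₀F, hgood₀⟩ := exists_goodPrime W
  -- the field: `S` inert, every other bad prime split, `2` split when good, `p₀` split, the twist with a simple zero
  obtain ⟨K, _, _, hK, -, hinert, hsplitN, hsplit2, -, hLt0, hLt1⟩ := hFH1 W hw S hSmult hSeven hSne p₀ hgood₀ 4
  have hodd : Odd (NumberField.discr K) := by
    by_cases h2S : 2 ∈ S
    · obtain ⟨hn, hd⟩ := hinert 2 h2S
      exact odd_discr_of_two_inert_or_split hK.1
        (Or.inl ⟨by simpa only [Nat.cast_ofNat] using hn, by simpa only [Nat.cast_ofNat] using hd⟩)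
    · by_cases h2N : 2 ∣ W.conductorNorm ℤ
      · have hn := hsplitN 2 Nat.prime_two h2N h2S
        exact odd_discr_of_two_inert_or_split hK.1 (Or.inr (by simpa only [Nat.cast_ofNat] using hn))
      · exact odd_discr_of_two_inert_or_split hK.1 (Or.inr (hsplit2 h2N))
  -- `3` splits (it is a bad prime outside `S`)
  have hbad3 : ¬ W.HasGoodReductionAtPrime 3 := not_good_of_addv W 3 hadd
  have h3S : 3 ∉ S := by
    intro h
    obtain ⟨_, hm⟩ := hSmult 3 h
    exact not_mult_of_addv W 3 hadd hm
  have h3N : 3 ∣ W.conductorNorm ℤ := (W.dvd_conductorNorm_iff_not_hasGoodReductionAtPrime 3).mpr hbad3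
  have hps2 : ((Ideal.span {((3 : ℕ) : ℤ)}).primesOver (𝓞 K)).ncard = 2 := hsplitN 3 hp h3N h3S
  have hH3 : SatisfiesHeegnerHypothesis 3 K := fun q hq hq3 ↦ by
    have : q = 3 := (Nat.prime_dvd_prime_iff_eq hq hp).mp hq3
    subst this; exact hps2
  -- the inert primes are `∥ N`
  have hSin : ∀ ℓ ∈ S, ℓ.Prime ∧ ℓ ∣ W.conductorNorm ℤ ∧ ¬ ℓ ^ 2 ∣ W.conductorNorm ℤ ∧
      ((Ideal.span {(ℓ : ℤ)}).primesOver (𝓞 K)).ncard = 1 ∧ ¬ (ℓ : ℤ) ∣ NumberField.discr K := by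
    intro ℓ hℓ
    obtain ⟨hℓF, hm⟩ := hSmult ℓ hℓ
    obtain ⟨hn, hd⟩ := hinert ℓ hℓ
    have hℓN : ℓ ∣ W.conductorNorm ℤ :=
      (W.dvd_conductorNorm_iff_not_hasGoodReductionAtPrime ℓ).mpr
        (WeierstrassCurve.HasMultiplicativeReduction.not_hasGoodReduction (R := ℤ_[ℓ]) hm)
    exact ⟨hℓF.out, hℓN, not_sq_dvd_conductorNorm_of_mult W ℓ hm, hn, hd⟩
  exact leafRankZeroUpper_three_of_shimuraInertDatum_at_pairing hGZK hmod hnf hJL hCO W hadd hsub hr rfl Dt hc S hSeven hSmult hFC hshape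
    hDEG K hK hodd hinert hsplitN hLt0 hLt1
    (shimuraHeegnerAt_of_fact W rfl K hK S hSeven hSin hsplitN hps2 Dt hHK hirr)
    (fun Wd _ _ Cd hWd ↦ partnerLowerSplitThreeRankOne_of_lowerRankOne hmod hL1 W hCM hadd hsub K hK hodd hH3 hLt0 hLt1 Wd Cd hWd)

/-! ## §U0.7.2 Σ★⁵₀ ⟹ Σ★⁶₀ -/

/-- **Σ★⁵₀ ⟹ Σ★⁶₀** (weakening: Σ★⁶₀ is Σ★⁵₀ with the third (DEG) disjunct of the negated nonempty-Shimura-row clause replaced by the PAIRING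
form, which every pair datum satisfies (`pairingRow_of_pairRow`, U₁ part 10)). Chain of record: 27493 ⟹ Σ★‴ ⟹ Σ★⁵₀ ⟹ Σ★⁶₀ by name.
[cite: Jetchev2008, Conj. 1.3 (p. 812)] -/
theorem sigmaStarOptOffPairingRowsNe_of_sigmaStarOptOffShimuraRowsNe
    (hStar : ∀ (W : WeierstrassCurve ℚ) [W.IsElliptic] [W.IsGloballyMinimal] (N : ℕ) [NeZero N]
      (K : Type) [Field K] [NumberField K]
      (Dt : ModularParametrizationData W N) (H : HeegnerDatum N (NumberField.discr K)) (ι : K →+* ℂ)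
      (P : (W.baseChange K).toAffine.Point),
      ¬ W.HasCM → Addv W 3 → SubGss W 3 → W.conductorNorm ℤ = N →
      (∀ z ∈ Dt.L.lattice, ∃ w ∈ periodLattice Dt.f, z = Dt.c * w) →
      ¬ (∃ (q : ℕ) (_ : Fact q.Prime), q ∣ N ∧
          padicValNat 3 W.tamagawaProduct ≤ padicValNat 3 ((W.baseChange ℚ_[q]).localTamagawaNumber ℤ_[q])) →
      ¬ ((∀ (q : ℕ) [Fact q.Prime], 3 ∣ (W.baseChange ℚ_[q]).localTamagawaNumber ℤ_[q] →
            W.HasSplitMultiplicativeReductionAtPrime q) ∧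
          ∃ S : Finset ℕ, S.Nonempty ∧ Even S.card ∧ (∀ ℓ ∈ S, ∃ _ : Fact ℓ.Prime, W.HasMultiplicativeReductionAtPrime ℓ) ∧
            (∀ (ℓ : ℕ) [Fact ℓ.Prime], ℓ ∉ S → W.HasSplitMultiplicativeReductionAtPrime ℓ →
              ¬ 3 ∣ padicValInt ℓ W.minimalDiscriminantInt) ∧
            ((∃ ℓ₀ ∈ S, ¬ 3 ∣ padicValInt ℓ₀ W.minimalDiscriminantInt) ∨
              (∃ ℓ₀ t : ℕ, ∃ _ : Fact ℓ₀.Prime, ∃ _ : Fact t.Prime,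
                W.HasMultiplicativeReductionAtPrime ℓ₀ ∧ W.HasMultiplicativeReductionAtPrime t ∧
                ℓ₀ ∉ S ∧ t ∉ S ∧ t ≠ ℓ₀ ∧ ¬ 3 ∣ padicValInt ℓ₀ W.minimalDiscriminantInt) ∨
              (∃ q₁ q₂ : ℕ, S = {q₁, q₂} ∧ q₁ ≠ q₂ ∧ q₂ ≠ 2 ∧ q₂ % 3 ≠ 1))) →
      IsImaginaryQuadratic K → SatisfiesHeegnerHypothesis N K →
      (WeierstrassCurve.Affine.Point.map ι.toRatAlgHom) P = heegnerPointComplex Dt H →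
      ¬ IsOfFinAddOrder P → Odd (NumberField.discr K) →
      ∀ (s' : ℕ), s' ≤ padicValNat 3 W.tamagawaProduct + padicValNat 3 Dt.c.natAbs →
      ∀ (n : ℕ) (d : KolyvaginHeegnerData Dt H.β ι n), Squarefree n →
      (∀ ℓ ∈ n.primeFactors, Zhang2014.IsKolyvaginPrime N W K 3 ℓ ∧ s' ≤ Zhang2014.kolyvaginIndex W 3 ℓ) →
      Koly.PDiv d 3 s') :
    ∀ (W : WeierstrassCurve ℚ) [W.IsElliptic] [W.IsGloballyMinimal] (N : ℕ) [NeZero N]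
      (K : Type) [Field K] [NumberField K]
      (Dt : ModularParametrizationData W N) (H : HeegnerDatum N (NumberField.discr K)) (ι : K →+* ℂ)
      (P : (W.baseChange K).toAffine.Point),
      ¬ W.HasCM → Addv W 3 → SubGss W 3 → W.conductorNorm ℤ = N →
      (∀ z ∈ Dt.L.lattice, ∃ w ∈ periodLattice Dt.f, z = Dt.c * w) →
      ¬ (∃ (q : ℕ) (_ : Fact q.Prime), q ∣ N ∧
          padicValNat 3 W.tamagawaProduct ≤ padicValNat 3 ((W.baseChange ℚ_[q]).localTamagawaNumber ℤ_[q])) →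
      ¬ ((∀ (q : ℕ) [Fact q.Prime], 3 ∣ (W.baseChange ℚ_[q]).localTamagawaNumber ℤ_[q] →
            W.HasSplitMultiplicativeReductionAtPrime q) ∧
          ∃ S : Finset ℕ, S.Nonempty ∧ Even S.card ∧ (∀ ℓ ∈ S, ∃ _ : Fact ℓ.Prime, W.HasMultiplicativeReductionAtPrime ℓ) ∧
            (∀ (ℓ : ℕ) [Fact ℓ.Prime], ℓ ∉ S → W.HasSplitMultiplicativeReductionAtPrime ℓ →
              ¬ 3 ∣ padicValInt ℓ W.minimalDiscriminantInt) ∧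
            ((∃ ℓ₀ ∈ S, ¬ 3 ∣ padicValInt ℓ₀ W.minimalDiscriminantInt) ∨
              (∃ ℓ₀ t : ℕ, ∃ _ : Fact ℓ₀.Prime, ∃ _ : Fact t.Prime,
                W.HasMultiplicativeReductionAtPrime ℓ₀ ∧ W.HasMultiplicativeReductionAtPrime t ∧
                ℓ₀ ∉ S ∧ t ∉ S ∧ t ≠ ℓ₀ ∧ ¬ 3 ∣ padicValInt ℓ₀ W.minimalDiscriminantInt) ∨
              (∃ R : Finset ℕ, R ⊆ S ∧ 2 * R.card = S.card ∧ ∀ q ∈ R, q = 2 ∨ ¬ 3 ∣ q - 1))) →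
      IsImaginaryQuadratic K → SatisfiesHeegnerHypothesis N K →
      (WeierstrassCurve.Affine.Point.map ι.toRatAlgHom) P = heegnerPointComplex Dt H →
      ¬ IsOfFinAddOrder P → Odd (NumberField.discr K) →
      ∀ (s' : ℕ), s' ≤ padicValNat 3 W.tamagawaProduct + padicValNat 3 Dt.c.natAbs →
      ∀ (n : ℕ) (d : KolyvaginHeegnerData Dt H.β ι n), Squarefree n →
      (∀ ℓ ∈ n.primeFactors, Zhang2014.IsKolyvaginPrime N W K 3 ℓ ∧ s' ≤ Zhang2014.kolyvaginIndex W 3 ℓ) →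
      Koly.PDiv d 3 s' := by
  intro W _ _ N _ K _ _ Dt H ι P hCM hadd hsub hN hopt hrow hSh hK hHN hP hnt hodd s' hs' n d hn hℓ
  refine hStar W N K Dt H ι P hCM hadd hsub hN hopt hrow ?_ hK hHN hP hnt hodd s' hs' n d hn hℓ
  rintro ⟨hshape, S, hSne, hSeven, hSmult, hFC, hDEG⟩
  apply hSh
  refine ⟨hshape, S, hSne, hSeven, hSmult, hFC, ?_⟩
  rcases hDEG with h₁ | h₂ | h₃
  · exact Or.inl h₁
  · exact Or.inr (Or.inl h₂)
  · exact Or.inr (Or.inr (pairingRow_of_pairRow hSmult h₃))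

/-! ## §U0.7.3 The composition of skeleton v9 -/

/-- **`LeafRankZeroUpperAtThree` ⟸ PUB₀⁺ ∧ F1–F3 ∧ SHIMURA FACTS₀ ∧ Σ★⁶₀ ∧ L₁ ∧ L₀ — the composition of skeleton v9 for U₀** (conclusion
literally the route decl). Part U0-4's v8 composition VERBATIM with the Shimura branch cut by the PAIRING clause and served by
`leafRankZeroUpper_three_of_shimuraInert_of_lowerRankOne_pairing`. Proof: optimal member `W₀ ∼ W`; at `W₀`: nonempty pairing-Shimura row ⇒
§U0.7.1 (no Σ, no L₀); else mono-carrier row ⇒ the any-carrier reading; else Σ★⁶₀ at the datum; transport back (Cassels + GZK).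
CONDITIONAL on every displayed input; U₀ stays OPEN; BSD is not proved.
-- adapted from Summits/BirchSwinnertonDyer/BirchSwinnertonDyer/Theorems/RamifiedHeegnerPairLeafRankZeroUpperAtThreeShimuraInertComposition.lean
[cite: JetchevSkinnerWan2017, §7.4.1–7.4.2, Thm. 4.4.1] [cite: CaiShuTian2014, Thm. 1.5] [cite: PastenShimura2024, Prop. 6.13, Lemmas 6.15–6.16, 6.18]
[cite: PapikianRabinoff2016, Cor. 3.5] [cite: Jetchev2008, Conj. 1.3, Thm. 1.4 (p. 812)] [cite: MatarNekovar2019, Thm. 0.7 (p. 456)] -/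
theorem leafRankZeroUpperAtThree_of_pubManin_of_namedFacts_of_shimuraFactsZero_of_sigmaStarOptOffPairingRowsNe_of_lowerRankOne_of_lowerRankZero
    (hpub : ((∀ (N : ℕ) [NeZero N] (W : WeierstrassCurve ℚ) (K : Type) [Field K] [NumberField K],
        Literature.NumberTheory.EllipticCurves.gross_zagier N W K) ∧
      (∀ (N : ℕ) [NeZero N] (W : WeierstrassCurve ℚ) (K : Type) [Field K] [NumberField K],
        Literature.NumberTheory.EllipticCurves.kolyvagin N W K) ∧
      Literature.NumberTheory.EllipticCurves.rank_eq_analyticRank_of_analyticRank_le_one ∧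
      WeierstrassCurve.hasEntireLFunction_rat ∧
      Literature.NumberTheory.EllipticCurves.MatarNekovar2019.thm07_padicValNat_card_sha_primary_add_le_of_globalDivisibility_of_irreducible ∧
      Literature.NumberTheory.EllipticCurves.ModularForms.exists_isNewformOf ∧
      Literature.NumberTheory.EllipticCurves.bumpFriedbergHoffstein_exists_heegnerField_split_twist_simpleZero ∧
      Literature.NumberTheory.EllipticCurves.ModularForms.nonempty_modularParametrizationData ∧
      WeierstrassCurve.bsdRHS_eq_of_isIsogenous ∧
      Literature.NumberTheory.EllipticCurves.ModularForms.mazur_not_dvd_maninConstant_of_odd ∧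
      Literature.NumberTheory.EllipticCurves.ModularForms.abbesUllmo_not_dvd_maninConstant_of_not_dvd_level ∧
      Literature.NumberTheory.EllipticCurves.ModularForms.cesnavicius_not_two_dvd_maninConstant_of_two_dvd_level))
    (h37 : GrossLMS1991.prop37_2_frobeniusCongruence)
    (hPT : ∀ (K : Type) [Field K] [NumberField K],
      Literature.NumberTheory.GaloisCohomology.poitouTate_selmerStructure_duality_conj K)
    (hF1 : Gross1991_heegnerPoint_sub_ratTorsion_mem_E0_imageFree)
    (hJL : nonempty_shimuraParametrizationData) (hCO : PastenShimura2024_componentOrders)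
    (hHK : shimuraCurve_heegnerPoint_grossZagier_kolyvagin)
    (hFH1 : friedbergHoffstein_exists_twist_simpleZero_inertAt_splitAt)
    (hStar : ∀ (W : WeierstrassCurve ℚ) [W.IsElliptic] [W.IsGloballyMinimal] (N : ℕ) [NeZero N]
      (K : Type) [Field K] [NumberField K]
      (Dt : ModularParametrizationData W N) (H : HeegnerDatum N (NumberField.discr K)) (ι : K →+* ℂ)
      (P : (W.baseChange K).toAffine.Point),
      ¬ W.HasCM → Addv W 3 → SubGss W 3 → W.conductorNorm ℤ = N →
      (∀ z ∈ Dt.L.lattice, ∃ w ∈ periodLattice Dt.f, z = Dt.c * w) →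
      ¬ (∃ (q : ℕ) (_ : Fact q.Prime), q ∣ N ∧
          padicValNat 3 W.tamagawaProduct ≤ padicValNat 3 ((W.baseChange ℚ_[q]).localTamagawaNumber ℤ_[q])) →
      ¬ ((∀ (q : ℕ) [Fact q.Prime], 3 ∣ (W.baseChange ℚ_[q]).localTamagawaNumber ℤ_[q] →
            W.HasSplitMultiplicativeReductionAtPrime q) ∧
          ∃ S : Finset ℕ, S.Nonempty ∧ Even S.card ∧ (∀ ℓ ∈ S, ∃ _ : Fact ℓ.Prime, W.HasMultiplicativeReductionAtPrime ℓ) ∧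
            (∀ (ℓ : ℕ) [Fact ℓ.Prime], ℓ ∉ S → W.HasSplitMultiplicativeReductionAtPrime ℓ →
              ¬ 3 ∣ padicValInt ℓ W.minimalDiscriminantInt) ∧
            ((∃ ℓ₀ ∈ S, ¬ 3 ∣ padicValInt ℓ₀ W.minimalDiscriminantInt) ∨
              (∃ ℓ₀ t : ℕ, ∃ _ : Fact ℓ₀.Prime, ∃ _ : Fact t.Prime,
                W.HasMultiplicativeReductionAtPrime ℓ₀ ∧ W.HasMultiplicativeReductionAtPrime t ∧
                ℓ₀ ∉ S ∧ t ∉ S ∧ t ≠ ℓ₀ ∧ ¬ 3 ∣ padicValInt ℓ₀ W.minimalDiscriminantInt) ∨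
              (∃ R : Finset ℕ, R ⊆ S ∧ 2 * R.card = S.card ∧ ∀ q ∈ R, q = 2 ∨ ¬ 3 ∣ q - 1))) →
      IsImaginaryQuadratic K → SatisfiesHeegnerHypothesis N K →
      (WeierstrassCurve.Affine.Point.map ι.toRatAlgHom) P = heegnerPointComplex Dt H →
      ¬ IsOfFinAddOrder P → Odd (NumberField.discr K) →
      ∀ (s' : ℕ), s' ≤ padicValNat 3 W.tamagawaProduct + padicValNat 3 Dt.c.natAbs →
      ∀ (n : ℕ) (d : KolyvaginHeegnerData Dt H.β ι n), Squarefree n →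
      (∀ ℓ ∈ n.primeFactors, Zhang2014.IsKolyvaginPrime N W K 3 ℓ ∧ s' ≤ Zhang2014.kolyvaginIndex W 3 ℓ) →
      Koly.PDiv d 3 s')
    (hL1 : Gss2LowerAtThreeRankOne) (hL0 : Gss2LowerAtThreeRankZero) :
    LeafRankZeroUpperAtThree := by
  intro W _ _ hCM hadd hsub hr
  obtain ⟨hGZ, hKo, hGZK, hmod, hMN, hnf, hBFH, -, hCassels, hM, hAU, hC2⟩ := hpub
  haveI : Fact (Nat.Prime 3) := ⟨Nat.prime_three⟩
  have hR₂ := JetchevReadingAnyCarrier.anyCarrierTwoSplitReading_of_namedFacts h37 hPT hF1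
  obtain ⟨W₀, hW₀, hW₀', N, hN0, D₀, hiso, hN₀, -, hopt, hCM₀, hadd₀, hsub₀, hr₀⟩ :=
    exists_optimal_leaf_member hnf W hCM hadd hsub
  haveI := hW₀
  haveI := hW₀'
  haveI := hN0
  have hr₀' : W₀.analyticRank = 0 := hr₀.trans hr
  -- settle U₀ at the optimal member `W₀` by the three-way row split
  have h₀ : MissingUpperBoundAt W₀ 3 := by
    subst hN₀
    have hc : ¬ (3 : ℤ) ∣ D₀.c := not_three_dvd_c_of_latticeOptimal_of_subGss hM hAU hC2 hnf W₀ D₀ hopt hadd₀ hsub₀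
    by_cases hSh : ((∀ (q : ℕ) [Fact q.Prime], 3 ∣ (W₀.baseChange ℚ_[q]).localTamagawaNumber ℤ_[q] →
            W₀.HasSplitMultiplicativeReductionAtPrime q) ∧
          ∃ S : Finset ℕ, S.Nonempty ∧ Even S.card ∧ (∀ ℓ ∈ S, ∃ _ : Fact ℓ.Prime, W₀.HasMultiplicativeReductionAtPrime ℓ) ∧
            (∀ (ℓ : ℕ) [Fact ℓ.Prime], ℓ ∉ S → W₀.HasSplitMultiplicativeReductionAtPrime ℓ →
              ¬ 3 ∣ padicValInt ℓ W₀.minimalDiscriminantInt) ∧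
            ((∃ ℓ₀ ∈ S, ¬ 3 ∣ padicValInt ℓ₀ W₀.minimalDiscriminantInt) ∨
              (∃ ℓ₀ t : ℕ, ∃ _ : Fact ℓ₀.Prime, ∃ _ : Fact t.Prime,
                W₀.HasMultiplicativeReductionAtPrime ℓ₀ ∧ W₀.HasMultiplicativeReductionAtPrime t ∧
                ℓ₀ ∉ S ∧ t ∉ S ∧ t ≠ ℓ₀ ∧ ¬ 3 ∣ padicValInt ℓ₀ W₀.minimalDiscriminantInt) ∨
              (∃ R : Finset ℕ, R ⊆ S ∧ 2 * R.card = S.card ∧ ∀ q ∈ R, q = 2 ∨ ¬ 3 ∣ q - 1)))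
    · -- a nonempty pairing-Shimura row: the inert-carrier road (§U0.7.1), no Σ, no L₀
      obtain ⟨hshape, S, hSne, hSeven, hSmult, hFC, hDEG⟩ := hSh
      exact leafRankZeroUpper_three_of_shimuraInert_of_lowerRankOne_pairing hGZK hmod hnf hJL hCO hHK hFH1 hL1 W₀ hCM₀ hadd₀ hsub₀
        hr₀' rfl D₀ hc S hSeven hSne hSmult hFC hshape hDEG
    · by_cases hrow : ∃ (q : ℕ) (_ : Fact q.Prime), q ∣ W₀.conductorNorm ℤ ∧
          padicValNat 3 W₀.tamagawaProduct ≤ padicValNat 3 ((W₀.baseChange ℚ_[q]).localTamagawaNumber ℤ_[q])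
      · -- a mono-carrier row: the any-carrier reading from F1–F3 (with L₁ and `W₀`'s own lower half from L₀)
        obtain ⟨q, _, hqN, hmono⟩ := hrow
        exact leafRankZeroUpper_three_monoCarrierAny_of_anyCarrierReading_of_lowerRankOne hGZ hKo hGZK hmod hMN hnf hBFH
          hR₂ hL1 W₀ hCM₀ hadd₀ hsub₀ hr₀' (hL0 W₀ hCM₀ hadd₀ hsub₀ hr₀') q hqN hmono D₀ hc
      · -- the research residue Σ★⁶₀ at the datum
        exact leafRankZeroUpper_three_of_sigmaAtDatum_of_lowerRankOne hGZ hKo hGZK hmod hMN hnf hBFH hL1 W₀ hCM₀ hadd₀ hsub₀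
          hr₀' (hL0 W₀ hCM₀ hadd₀ hsub₀ hr₀') D₀ (fun K _ _ H ι P hK hHN _ _ hP hnt hodd s' hs' n d hn hℓ ↦
            hStar W₀ (W₀.conductorNorm ℤ) K D₀ H ι P hCM₀ hadd₀ hsub₀ rfl hopt hrow hSh hK hHN hP hnt hodd s' hs' n d hn hℓ)
  -- and transport it back along `W ∼ W₀`
  exact missingUpperBoundAt_of_isIsogenous_of_analyticRank_le_one hCassels hGZK hmod (by rw [hr]; exact zero_le_one) hiso h₀

end Summit.BirchSwinnertonDyer.BirchSwinnertonDyer.Theorems.LeafShimuraInert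

end
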